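import Summits.QuantumFields.YangMills.Theorems.BalabanUVNodesPortU8TwoVolumeRowCapped

/-!
# PORT PT-B (U8), g4 file 2 — ★★★ `rowR4D_LocUniv_sandwich`: THE GLOBAL TWO-VOLUME ROW (R4ᴰ)′ FOR THE WHOLE-TORUS LOCALIZED (Landau, chart-unit) LINEAR RESPONSE
# `recordGkLocWξ F θ k K Finset.univ a y`, from the ‴-clauses on `recordHrLocξ … Finset.univ` and Tok-cmpU-cap ONLY — SELECTOR-FREE: no `recordHr`, no `recordBgField`,
# no `UkSel`, no `rootGauge`, no Tok-182, no analyticity hypothesis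

Cell `ym-nodeO-ideate` ∕ `ym-balaban-port`, porter `ymgap-nodeO-port-PTB-1` (gen 4).  JOIN-side helper for the decay road of **stmt-QuantumFields-27238** (K0ᴬ),
`--supports stmt-QuantumFields-27238 --as helper`, answering ★★★ director-ym №509 (iii′) ∕ №512 («the U8-type supply of the K0ᴬ decay road comes from
`recordHrLocξ`-objects»).  [I] = [Balaban1987RG1], [15] = [Balaban1985Variational], [B6] = [Balaban1984PropagatorsII].

WHAT IS PROVED (kernel, sorry-free): the instance of g4 file 1 (✓`sandwich_clauses_capped`, ✓`rowR4D_capped_sandwich`) at `G := recordHrLocξ F θ k K Finset.univ a y`,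
`g := recordGkLocWξ F θ k K Finset.univ a y` (𝐔-block ✓`chartMatU_cutTo_recordGkLocWξ`, 𝐉-block ✓`chartMatJc_cutTo_recordGkLocWξ` + the CLOSED FORM ✓`recordJLocξ_eq` —
hypothesis-free): `sandwich_clauses_LocUniv`, ★★★ `rowR4D_LocUniv_sandwich`.  The displayed inputs are EXACTLY (‴-LocUniv) the four (190)-clauses VERBATIM with
`Hr := recordHrLocξ … Finset.univ a y` at members `K`, `K+1` ([15] Prop. 9 p.309 ∕ (190) p.308 for the torus Landau propagator; whole-torus window = [B6] (2.5)–(2.6) with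
`Ω₀ = T`) and (Tok-cmpU-cap) VERBATIM (v11-G₄ `hL.2.2`, [I] p.290 L17–20) at members `K`, `K+1`.  The conclusion is the (R4ᴰ) clause of `B12FormatPlus.Response9D` for the
data `Gk n := recordGkLocWξ … (K₀+n) Finset.univ a` at one member ∕ domain ∕ N-slot label, with the constant of ✓`rowR4D_L_sandwich`.

HONEST FRAMING.  Helpers over DISPLAYED token-shaped hypotheses (asserted by nobody); nothing of Bałaban's analysis is asserted ∕ ported ∕ discharged here; 27931 is CLOSED ·
IMPLICATION-ONLY (unchanged by this file); K0ᴬ 27238 OPEN; NODE O 0∕1; COUNT 8∕28 · K 1∕4 UNMOVED; finite `𝕋⁴_{L^K}` at fixed ε — NOT continuum ∕ OS ∕ Clay;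
**the Yang–Mills mass gap (Clay) is NOT proved by any of this.**
-/

noncomputable section

open scoped BigOperators Matrix.Norms.L2Operator
open Complex (I)

namespace Summit.QuantumFields.YangMills.Theorems.PortU8

open Literature.MathematicalPhysics.QuantumFieldTheory.Balaban1983to89
open Literature.MathematicalPhysics.QuantumFieldTheory.Balaban1983to89.Node00
open Literature.MathematicalPhysics.QuantumFieldTheory.Balaban1983to89.T4Continuum (T4Family)
open Literature.MathematicalPhysics.QuantumFieldTheory.Balaban1983to89.B14.Eq213MaximalDomains (side)
open Summit.QuantumFields.YangMills.Theorems.K0RecordFormatNames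

variable (F : T4Family)

/-! ## §1  ★★★ The WHOLE-TORUS LOCALIZED (Landau, chart-unit) linear response — selector-free (R4ᴰ)′ -/

section LocUniv

variable {F}
variable (a₀ ε₂₉ : ℝ) {Mc k K : ℕ}

/-- ★★ **THE SANDWICH CLAUSES FOR THE WHOLE-TORUS LOCALIZED RESPONSE** `E := HrLocξ_{K+1}(univ)(y′) ∘ lift − HrLocξ_K(univ)(y)`: ✓`sandwich_clauses_capped` with `G := recordHrLocξ … K Finset.univ a y`,
`G′ := recordHrLocξ … (K+1) Finset.univ a y′` — the displayed inputs are the ‴-clauses on the whole-torus localized response (both members) and Tok-cmpU-cap VERBATIM (both members);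
no `recordHr`, no Tok-182. [cite: Balaban1985Variational, (190) p.308, Prop. 9 p.309; Balaban1987RG1, (1.21) p.264, p.290 L17–20; Balaban1984PropagatorsII, (2.5)–(2.6) p.224, (2.35) p.228] -/
theorem sandwich_clauses_LocUniv (hMc : McGuard F Mc) (hK : recordK₀ F Mc k ≤ K) (a : (thetaFill F a₀ ε₂₉).ιβ) (μ : Fin 4) (z : Fin 4 → ℤ)
    (hz : ∀ l, 2 * |z l| < (recordRNat F Mc k K : ℤ)) {X : (recordDomSys F Mc k K).Dom} (hX : X ∉ recordWrapCtr F Mc k K)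
    {C δ₉ : ℝ} (hC : 0 ≤ C) (hδ : 0 < δ₉)
    (h3 : letI Hr := recordHrLocξ F (thetaFill F a₀ ε₂₉) k K Finset.univ a (recordE F k K μ z);
      ∀ b : PBond (F.P K) 0,
        ‖Hr b‖ ≤ C * (F.P K).eta (k + 1) * Real.exp (-(δ₉ * (Site.tdist (coarsenTo (k + 1) b.src) (recordE F k K μ z).2 : ℝ))) ∧
        (∀ ν : Fin (F.P K).d, ‖Hr ⟨b.src.shift ν, b.dir⟩ - Hr b‖ ≤ C * (F.P K).eta (k + 1) ^ 2 * Real.exp (-(δ₉ * (Site.tdist (coarsenTo (k + 1) b.src) (recordE F k K μ z).2 : ℝ)))) ∧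
        ‖∑ ν : Fin (F.P K).d, (Hr ⟨b.src.shift ν, b.dir⟩ - (2 : ℂ) • Hr b + Hr ⟨b.src.unshift ν, b.dir⟩)‖ ≤
          C * (F.P K).eta (k + 1) ^ 3 * Real.exp (-(δ₉ * (Site.tdist (coarsenTo (k + 1) b.src) (recordE F k K μ z).2 : ℝ))) ∧
        ‖∑ ν : Fin (F.P K).d, ((Hr ⟨b.src, b.dir⟩ + Hr ⟨(b.src).shift b.dir, ν⟩ - Hr ⟨(b.src).shift ν, b.dir⟩ - Hr ⟨b.src, ν⟩) -
          (Hr ⟨b.src.unshift ν, b.dir⟩ + Hr ⟨(b.src.unshift ν).shift b.dir, ν⟩ - Hr ⟨(b.src.unshift ν).shift ν, b.dir⟩ - Hr ⟨b.src.unshift ν, ν⟩))‖ ≤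
          C * (F.P K).eta (k + 1) ^ 3 * Real.exp (-(δ₉ * (Site.tdist (coarsenTo (k + 1) b.src) (recordE F k K μ z).2 : ℝ))))
    (h3' : letI Hr := recordHrLocξ F (thetaFill F a₀ ε₂₉) k (K + 1) Finset.univ a (recordE F k (K + 1) μ z);
      ∀ b : PBond (F.P (K + 1)) 0,
        ‖Hr b‖ ≤ C * (F.P (K + 1)).eta (k + 1) * Real.exp (-(δ₉ * (Site.tdist (coarsenTo (k + 1) b.src) (recordE F k (K + 1) μ z).2 : ℝ))) ∧
        (∀ ν : Fin (F.P (K + 1)).d, ‖Hr ⟨b.src.shift ν, b.dir⟩ - Hr b‖ ≤ C * (F.P (K + 1)).eta (k + 1) ^ 2 * Real.exp (-(δ₉ * (Site.tdist (coarsenTo (k + 1) b.src) (recordE F k (K + 1) μ z).2 : ℝ)))) ∧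
        ‖∑ ν : Fin (F.P (K + 1)).d, (Hr ⟨b.src.shift ν, b.dir⟩ - (2 : ℂ) • Hr b + Hr ⟨b.src.unshift ν, b.dir⟩)‖ ≤
          C * (F.P (K + 1)).eta (k + 1) ^ 3 * Real.exp (-(δ₉ * (Site.tdist (coarsenTo (k + 1) b.src) (recordE F k (K + 1) μ z).2 : ℝ))) ∧
        ‖∑ ν : Fin (F.P (K + 1)).d, ((Hr ⟨b.src, b.dir⟩ + Hr ⟨(b.src).shift b.dir, ν⟩ - Hr ⟨(b.src).shift ν, b.dir⟩ - Hr ⟨b.src, ν⟩) -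
          (Hr ⟨b.src.unshift ν, b.dir⟩ + Hr ⟨(b.src.unshift ν).shift b.dir, ν⟩ - Hr ⟨(b.src.unshift ν).shift ν, b.dir⟩ - Hr ⟨b.src.unshift ν, ν⟩))‖ ≤
          C * (F.P (K + 1)).eta (k + 1) ^ 3 * Real.exp (-(δ₉ * (Site.tdist (coarsenTo (k + 1) b.src) (recordE F k (K + 1) μ z).2 : ℝ))))
    (hcmp : ∀ R3 R0 : ℕ, R3 + nestRadius Mc 1 ≤ R0 → 2 * (R0 + 1) < (F.P K).sitesPerDir (k + 1) → ∀ z₀ : Fin 4 → ℤ, (recordE F k K μ z).2 ∈ recordWindow F k K R3 z₀ →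
      letI Hd : PBond (F.P K) 0 → Fin 2 → Fin 2 → ℂ := fun b' => recordHrLocξ F (thetaFill F a₀ ε₂₉) k K Finset.univ a (recordE F k K μ z) b' -
        recordHrLocξ F (thetaFill F a₀ ε₂₉) k K (recordWindow F k K R0 z₀) a (recordE F k K μ z) b';
      ∀ b : PBond (F.P K) 0, coarsenTo (k + 1) b.src ∈ recordWindow F k K R3 z₀ →
        ‖Hd b‖ ≤ C * (F.P K).eta (k + 1) * Real.exp (-(δ₉ * ((R0 : ℝ) - (R3 : ℝ)))) ∧
        (∀ ν : Fin (F.P K).d, ‖Hd ⟨b.src.shift ν, b.dir⟩ - Hd b‖ ≤ C * (F.P K).eta (k + 1) ^ 2 * Real.exp (-(δ₉ * ((R0 : ℝ) - (R3 : ℝ))))) ∧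
        ‖∑ ν : Fin (F.P K).d, (Hd ⟨b.src.shift ν, b.dir⟩ - (2 : ℂ) • Hd b + Hd ⟨b.src.unshift ν, b.dir⟩)‖ ≤ C * (F.P K).eta (k + 1) ^ 3 * Real.exp (-(δ₉ * ((R0 : ℝ) - (R3 : ℝ)))) ∧
        ‖∑ ν : Fin (F.P K).d, ((Hd ⟨b.src, b.dir⟩ + Hd ⟨(b.src).shift b.dir, ν⟩ - Hd ⟨(b.src).shift ν, b.dir⟩ - Hd ⟨b.src, ν⟩) -
          (Hd ⟨b.src.unshift ν, b.dir⟩ + Hd ⟨(b.src.unshift ν).shift b.dir, ν⟩ - Hd ⟨(b.src.unshift ν).shift ν, b.dir⟩ - Hd ⟨b.src.unshift ν, ν⟩))‖ ≤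
          C * (F.P K).eta (k + 1) ^ 3 * Real.exp (-(δ₉ * ((R0 : ℝ) - (R3 : ℝ)))))
    (hcmp' : ∀ R3 R0 : ℕ, R3 + nestRadius Mc 1 ≤ R0 → 2 * (R0 + 1) < (F.P (K + 1)).sitesPerDir (k + 1) → ∀ z₀ : Fin 4 → ℤ, (recordE F k (K + 1) μ z).2 ∈ recordWindow F k (K + 1) R3 z₀ →
      letI Hd : PBond (F.P (K + 1)) 0 → Fin 2 → Fin 2 → ℂ := fun b' => recordHrLocξ F (thetaFill F a₀ ε₂₉) k (K + 1) Finset.univ a (recordE F k (K + 1) μ z) b' -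
        recordHrLocξ F (thetaFill F a₀ ε₂₉) k (K + 1) (recordWindow F k (K + 1) R0 z₀) a (recordE F k (K + 1) μ z) b';
      ∀ b : PBond (F.P (K + 1)) 0, coarsenTo (k + 1) b.src ∈ recordWindow F k (K + 1) R3 z₀ →
        ‖Hd b‖ ≤ C * (F.P (K + 1)).eta (k + 1) * Real.exp (-(δ₉ * ((R0 : ℝ) - (R3 : ℝ)))) ∧
        (∀ ν : Fin (F.P (K + 1)).d, ‖Hd ⟨b.src.shift ν, b.dir⟩ - Hd b‖ ≤ C * (F.P (K + 1)).eta (k + 1) ^ 2 * Real.exp (-(δ₉ * ((R0 : ℝ) - (R3 : ℝ))))) ∧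
        ‖∑ ν : Fin (F.P (K + 1)).d, (Hd ⟨b.src.shift ν, b.dir⟩ - (2 : ℂ) • Hd b + Hd ⟨b.src.unshift ν, b.dir⟩)‖ ≤ C * (F.P (K + 1)).eta (k + 1) ^ 3 * Real.exp (-(δ₉ * ((R0 : ℝ) - (R3 : ℝ)))) ∧
        ‖∑ ν : Fin (F.P (K + 1)).d, ((Hd ⟨b.src, b.dir⟩ + Hd ⟨(b.src).shift b.dir, ν⟩ - Hd ⟨(b.src).shift ν, b.dir⟩ - Hd ⟨b.src, ν⟩) -
          (Hd ⟨b.src.unshift ν, b.dir⟩ + Hd ⟨(b.src.unshift ν).shift b.dir, ν⟩ - Hd ⟨(b.src.unshift ν).shift ν, b.dir⟩ - Hd ⟨b.src.unshift ν, ν⟩))‖ ≤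
          C * (F.P (K + 1)).eta (k + 1) ^ 3 * Real.exp (-(δ₉ * ((R0 : ℝ) - (R3 : ℝ)))))
    {β : PBond (F.P K) 0} (hβ : β ∈ domBonds F Mc k K X) :
    letI E : PBond (F.P K) 0 → Fin 2 → Fin 2 → ℂ := fun b' => recordHrLocξ F (thetaFill F a₀ ε₂₉) k (K + 1) Finset.univ a (recordE F k (K + 1) μ z) (liftBondCtr F K 0 b') -
      recordHrLocξ F (thetaFill F a₀ ε₂₉) k K Finset.univ a (recordE F k K μ z) b'
    letI Ch : ℝ := 2 * C * Real.exp (δ₉ * (2 * Mc + 2)) * Real.exp (-(δ₉ / 8) * recordRNat F Mc k K)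
    letI e : ℝ := Real.exp (-(δ₉ / 8 * (Site.tdist (coarsenTo (k + 1) β.src) (recordE F k K μ z).2 : ℝ)))
    ‖E ⟨β.src, β.dir⟩‖ ≤ Ch * (F.P K).eta (k + 1) * e ∧
    (∀ ν : Fin (F.P K).d, ‖E ⟨β.src.shift ν, β.dir⟩ - E ⟨β.src, β.dir⟩‖ ≤ Ch * (F.P K).eta (k + 1) ^ 2 * e) ∧
    ‖∑ ν : Fin (F.P K).d, (E ⟨β.src.shift ν, β.dir⟩ - (2 : ℂ) • E ⟨β.src, β.dir⟩ + E ⟨β.src.unshift ν, β.dir⟩)‖ ≤ Ch * (F.P K).eta (k + 1) ^ 3 * e ∧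
    ‖∑ ν : Fin (F.P K).d, ((E ⟨β.src, β.dir⟩ + E ⟨β.src.shift β.dir, ν⟩ - E ⟨β.src.shift ν, β.dir⟩ - E ⟨β.src, ν⟩) -
      (E ⟨β.src.unshift ν, β.dir⟩ + E ⟨(β.src.unshift ν).shift β.dir, ν⟩ - E ⟨(β.src.unshift ν).shift ν, β.dir⟩ - E ⟨β.src.unshift ν, ν⟩))‖ ≤ Ch * (F.P K).eta (k + 1) ^ 3 * e :=
  sandwich_clauses_capped a₀ ε₂₉ hMc hK a μ z hz hX hC hδ _ _ h3 h3' hcmp hcmp' hβ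

/-- ★★★ **ROW (R4ᴰ)′ FOR THE WHOLE-TORUS LOCALIZED DATA `recordGkLocWξ … Finset.univ` BY THE SANDWICH — SELECTOR-FREE** (one member `K`, one off-wrap domain `X`, one N-slot label):
under the ‴-clauses on `recordHrLocξ … Finset.univ` at both members and Tok-cmpU-cap at both members (DISPLAYED, asserted by nobody), the gauge of the cut two-volume difference of
the whole-torus localized (Landau, chart-unit) linear responses is `≤ C₄ · e^{−(δ₉∕4)·ρ∕2} · e^{−((δ₉∕4)∕2)·dist(y, X)}`, `C₄ = 2C·e^{δ₉(2Mc+2)}·2(3 + 2‖π_ℝ‖)e^{(δ₉∕2)Mc}∕α₂` (`C > 0`);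
the `𝐉`-block is the linearised current in CLOSED FORM (✓`recordJLocξ_eq`), so no analyticity premise and no `recordHr` ∕ `recordBgField` ∕ `UkSel` ∕ `rootGauge` ∕ Tok-182 enter.
[cite: Balaban1987RG1, (1.21) p.264, (4.4)–(4.5) pp.281–282, p.290 L17–20, (4.35) p.290, (1.8) p.261; Balaban1985Variational, (190) p.308, Prop. 9 p.309; Balaban1984PropagatorsII, (2.5)–(2.6) p.224, (2.35) p.228] -/
theorem rowR4D_LocUniv_sandwich (hMc : McGuard F Mc) (hK : recordK₀ F Mc k ≤ K) (a : (thetaFill F a₀ ε₂₉).ιβ) (μ : Fin 4) (z : Fin 4 → ℤ)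
    (hz : ∀ l, 2 * |z l| < (recordRNat F Mc k K : ℤ)) {X : (recordDomSys F Mc k K).Dom} (hX : X ∉ recordWrapCtr F Mc k K)
    {C δ₉ : ℝ} (hC : 0 < C) (hδ : 0 < δ₉)
    (h3 : letI Hr := recordHrLocξ F (thetaFill F a₀ ε₂₉) k K Finset.univ a (recordE F k K μ z);
      ∀ b : PBond (F.P K) 0,
        ‖Hr b‖ ≤ C * (F.P K).eta (k + 1) * Real.exp (-(δ₉ * (Site.tdist (coarsenTo (k + 1) b.src) (recordE F k K μ z).2 : ℝ))) ∧
        (∀ ν : Fin (F.P K).d, ‖Hr ⟨b.src.shift ν, b.dir⟩ - Hr b‖ ≤ C * (F.P K).eta (k + 1) ^ 2 * Real.exp (-(δ₉ * (Site.tdist (coarsenTo (k + 1) b.src) (recordE F k K μ z).2 : ℝ)))) ∧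
        ‖∑ ν : Fin (F.P K).d, (Hr ⟨b.src.shift ν, b.dir⟩ - (2 : ℂ) • Hr b + Hr ⟨b.src.unshift ν, b.dir⟩)‖ ≤
          C * (F.P K).eta (k + 1) ^ 3 * Real.exp (-(δ₉ * (Site.tdist (coarsenTo (k + 1) b.src) (recordE F k K μ z).2 : ℝ))) ∧
        ‖∑ ν : Fin (F.P K).d, ((Hr ⟨b.src, b.dir⟩ + Hr ⟨(b.src).shift b.dir, ν⟩ - Hr ⟨(b.src).shift ν, b.dir⟩ - Hr ⟨b.src, ν⟩) -
          (Hr ⟨b.src.unshift ν, b.dir⟩ + Hr ⟨(b.src.unshift ν).shift b.dir, ν⟩ - Hr ⟨(b.src.unshift ν).shift ν, b.dir⟩ - Hr ⟨b.src.unshift ν, ν⟩))‖ ≤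
          C * (F.P K).eta (k + 1) ^ 3 * Real.exp (-(δ₉ * (Site.tdist (coarsenTo (k + 1) b.src) (recordE F k K μ z).2 : ℝ))))
    (h3' : letI Hr := recordHrLocξ F (thetaFill F a₀ ε₂₉) k (K + 1) Finset.univ a (recordE F k (K + 1) μ z);
      ∀ b : PBond (F.P (K + 1)) 0,
        ‖Hr b‖ ≤ C * (F.P (K + 1)).eta (k + 1) * Real.exp (-(δ₉ * (Site.tdist (coarsenTo (k + 1) b.src) (recordE F k (K + 1) μ z).2 : ℝ))) ∧
        (∀ ν : Fin (F.P (K + 1)).d, ‖Hr ⟨b.src.shift ν, b.dir⟩ - Hr b‖ ≤ C * (F.P (K + 1)).eta (k + 1) ^ 2 * Real.exp (-(δ₉ * (Site.tdist (coarsenTo (k + 1) b.src) (recordE F k (K + 1) μ z).2 : ℝ)))) ∧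
        ‖∑ ν : Fin (F.P (K + 1)).d, (Hr ⟨b.src.shift ν, b.dir⟩ - (2 : ℂ) • Hr b + Hr ⟨b.src.unshift ν, b.dir⟩)‖ ≤
          C * (F.P (K + 1)).eta (k + 1) ^ 3 * Real.exp (-(δ₉ * (Site.tdist (coarsenTo (k + 1) b.src) (recordE F k (K + 1) μ z).2 : ℝ))) ∧
        ‖∑ ν : Fin (F.P (K + 1)).d, ((Hr ⟨b.src, b.dir⟩ + Hr ⟨(b.src).shift b.dir, ν⟩ - Hr ⟨(b.src).shift ν, b.dir⟩ - Hr ⟨b.src, ν⟩) -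
          (Hr ⟨b.src.unshift ν, b.dir⟩ + Hr ⟨(b.src.unshift ν).shift b.dir, ν⟩ - Hr ⟨(b.src.unshift ν).shift ν, b.dir⟩ - Hr ⟨b.src.unshift ν, ν⟩))‖ ≤
          C * (F.P (K + 1)).eta (k + 1) ^ 3 * Real.exp (-(δ₉ * (Site.tdist (coarsenTo (k + 1) b.src) (recordE F k (K + 1) μ z).2 : ℝ))))
    (hcmp : ∀ R3 R0 : ℕ, R3 + nestRadius Mc 1 ≤ R0 → 2 * (R0 + 1) < (F.P K).sitesPerDir (k + 1) → ∀ z₀ : Fin 4 → ℤ, (recordE F k K μ z).2 ∈ recordWindow F k K R3 z₀ →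
      letI Hd : PBond (F.P K) 0 → Fin 2 → Fin 2 → ℂ := fun b' => recordHrLocξ F (thetaFill F a₀ ε₂₉) k K Finset.univ a (recordE F k K μ z) b' -
        recordHrLocξ F (thetaFill F a₀ ε₂₉) k K (recordWindow F k K R0 z₀) a (recordE F k K μ z) b';
      ∀ b : PBond (F.P K) 0, coarsenTo (k + 1) b.src ∈ recordWindow F k K R3 z₀ →
        ‖Hd b‖ ≤ C * (F.P K).eta (k + 1) * Real.exp (-(δ₉ * ((R0 : ℝ) - (R3 : ℝ)))) ∧
        (∀ ν : Fin (F.P K).d, ‖Hd ⟨b.src.shift ν, b.dir⟩ - Hd b‖ ≤ C * (F.P K).eta (k + 1) ^ 2 * Real.exp (-(δ₉ * ((R0 : ℝ) - (R3 : ℝ))))) ∧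
        ‖∑ ν : Fin (F.P K).d, (Hd ⟨b.src.shift ν, b.dir⟩ - (2 : ℂ) • Hd b + Hd ⟨b.src.unshift ν, b.dir⟩)‖ ≤ C * (F.P K).eta (k + 1) ^ 3 * Real.exp (-(δ₉ * ((R0 : ℝ) - (R3 : ℝ)))) ∧
        ‖∑ ν : Fin (F.P K).d, ((Hd ⟨b.src, b.dir⟩ + Hd ⟨(b.src).shift b.dir, ν⟩ - Hd ⟨(b.src).shift ν, b.dir⟩ - Hd ⟨b.src, ν⟩) -
          (Hd ⟨b.src.unshift ν, b.dir⟩ + Hd ⟨(b.src.unshift ν).shift b.dir, ν⟩ - Hd ⟨(b.src.unshift ν).shift ν, b.dir⟩ - Hd ⟨b.src.unshift ν, ν⟩))‖ ≤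
          C * (F.P K).eta (k + 1) ^ 3 * Real.exp (-(δ₉ * ((R0 : ℝ) - (R3 : ℝ)))))
    (hcmp' : ∀ R3 R0 : ℕ, R3 + nestRadius Mc 1 ≤ R0 → 2 * (R0 + 1) < (F.P (K + 1)).sitesPerDir (k + 1) → ∀ z₀ : Fin 4 → ℤ, (recordE F k (K + 1) μ z).2 ∈ recordWindow F k (K + 1) R3 z₀ →
      letI Hd : PBond (F.P (K + 1)) 0 → Fin 2 → Fin 2 → ℂ := fun b' => recordHrLocξ F (thetaFill F a₀ ε₂₉) k (K + 1) Finset.univ a (recordE F k (K + 1) μ z) b' -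
        recordHrLocξ F (thetaFill F a₀ ε₂₉) k (K + 1) (recordWindow F k (K + 1) R0 z₀) a (recordE F k (K + 1) μ z) b';
      ∀ b : PBond (F.P (K + 1)) 0, coarsenTo (k + 1) b.src ∈ recordWindow F k (K + 1) R3 z₀ →
        ‖Hd b‖ ≤ C * (F.P (K + 1)).eta (k + 1) * Real.exp (-(δ₉ * ((R0 : ℝ) - (R3 : ℝ)))) ∧
        (∀ ν : Fin (F.P (K + 1)).d, ‖Hd ⟨b.src.shift ν, b.dir⟩ - Hd b‖ ≤ C * (F.P (K + 1)).eta (k + 1) ^ 2 * Real.exp (-(δ₉ * ((R0 : ℝ) - (R3 : ℝ))))) ∧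
        ‖∑ ν : Fin (F.P (K + 1)).d, (Hd ⟨b.src.shift ν, b.dir⟩ - (2 : ℂ) • Hd b + Hd ⟨b.src.unshift ν, b.dir⟩)‖ ≤ C * (F.P (K + 1)).eta (k + 1) ^ 3 * Real.exp (-(δ₉ * ((R0 : ℝ) - (R3 : ℝ)))) ∧
        ‖∑ ν : Fin (F.P (K + 1)).d, ((Hd ⟨b.src, b.dir⟩ + Hd ⟨(b.src).shift b.dir, ν⟩ - Hd ⟨(b.src).shift ν, b.dir⟩ - Hd ⟨b.src, ν⟩) -
          (Hd ⟨b.src.unshift ν, b.dir⟩ + Hd ⟨(b.src.unshift ν).shift b.dir, ν⟩ - Hd ⟨(b.src.unshift ν).shift ν, b.dir⟩ - Hd ⟨b.src.unshift ν, ν⟩))‖ ≤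
          C * (F.P (K + 1)).eta (k + 1) ^ 3 * Real.exp (-(δ₉ * ((R0 : ℝ) - (R3 : ℝ)))))
    {α₂ : ℝ} (hα : 0 < α₂) :
    gauge (recordDom44J F Mc k K X α₂) (B12FormatPlus.cutTo (recordCXJ F Mc k K X) fun i =>
        recordGkLocWξ F (thetaFill F a₀ ε₂₉) k (K + 1) Finset.univ a (recordE F k (K + 1) μ z) (recordJXJ F K i) -
          recordGkLocWξ F (thetaFill F a₀ ε₂₉) k K Finset.univ a (recordE F k K μ z) i) ≤
      (2 * C * Real.exp (δ₉ * (2 * Mc + 2)) * (2 * (2 * 1 + 2 * ‖LinearMap.toContinuousLinearMap (sl2Proj.restrictScalars ℝ)‖ + 1) * Real.exp (4 * (δ₉ / 8) * Mc) / α₂)) *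
        Real.exp (-(δ₉ / 4) * (recordRNat F Mc k K : ℝ) / 2) * Real.exp (-((δ₉ / 4) / 2) * (recordSiteGeom F Mc k K).distD (recordE F k K μ z) X) := by
  classical
  refine rowR4D_capped_sandwich a₀ ε₂₉ hMc hK a μ z hz hX hC hδ
    (recordHrLocξ F (thetaFill F a₀ ε₂₉) k K Finset.univ a (recordE F k K μ z))
    (recordHrLocξ F (thetaFill F a₀ ε₂₉) k (K + 1) Finset.univ a (recordE F k (K + 1) μ z)) _ _
    (fun b hb => by rw [chartMatU_cutTo_recordGkLocWξ, if_pos hb])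
    (fun b' hb' => by rw [chartMatU_cutTo_recordGkLocWξ, if_pos hb'])
    (fun b hb => by rw [chartMatJc_cutTo_recordGkLocWξ, if_pos hb, recordJLocξ_eq])
    (fun b' hb' => by rw [chartMatJc_cutTo_recordGkLocWξ, if_pos hb', recordJLocξ_eq])
    h3 h3' hcmp hcmp' hα

end LocUniv

end Summit.QuantumFields.YangMills.Theorems.PortU8

end
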